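import Mathlib.MeasureTheory.Function.ConvergenceInMeasure
import Mathlib.MeasureTheory.Integral.MeanInequalities
import Mathlib.Analysis.MeanInequalitiesPow
import HarnessLib

/-!
# Upgrading strong `L²` convergence to strong `L³` convergence under a uniform `L^{10/3}` bound

Analysis/FunctionSpaces support file (theorems only, general measure spaces). The elementary
real-variable step of every compactness argument for (suitable) weak solutions of the
Navier–Stokes equations in three dimensions (Caffarelli–Kohn–Nirenberg 1982, §2; Lin 1998,
Thm. 2.2; Lemarié-Rieusset 2016, Thm. 14.1, Step 3; Bradshaw–Tsai 2019, §4.3, arXiv p. 12: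
"`vₖ` are uniformly bounded in `L^∞(0,T;L²(B₁)) ∩ L²(0,T;H¹(B₁))`, hence also in
`L^{10/3}(0,T;L^{10/3}(B₁))` … `vₖ` converges to `v` … in `L²(0,T;L²(B₁))`, … in
`L³(0,T;L³(B₁))`"): strong `L²` convergence plus a uniform bound in `L^{10/3}` gives strong
convergence in `L³` (indeed in every `L^q`, `q < 10/3`), by the Lebesgue interpolation
`‖h‖₃ ≤ ‖h‖₂^{1/6} ‖h‖_{10/3}^{5/6}`.

* `lintegral_enorm_rpow_three_le_sq_tenThirds` — `∫ |h|³ ≤ (∫ |h|²)^{1/4} (∫ |h|^{10/3})^{3/4}`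
  (Hölder with exponents `4`, `4/3` on `|h|^{1/2} · |h|^{5/2}`);
* `lintegral_enorm_rpow_le_of_tendsto_lintegral_sq` — a uniform bound `∫ |fₖ|^r ≤ M` passes to
  the `L²` limit `g` (`∫ |g|^r ≤ M`): a.e. convergence along a subsequence and Fatou;
* `tendsto_lintegral_enorm_rpow_three_of_sq_of_tenThirds` — `fₖ → g` in `L²` and
  `∫ |fₖ|^{10/3} ≤ M < ∞` imply `∫ |fₖ − g|³ → 0`; `tendsto_eLpNorm_three_of_sq_of_tenThirds` is the
  `eLpNorm` form, and `memLp_three_of_lintegral_tenThirds_le` records `L^{10/3} ⊂ L³` on finite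
  measure spaces.

## Mathlib search

Mathlib (this pin) has Hölder (`ENNReal.lintegral_mul_le_Lp_mul_Lq`), convergence in measure from
`L^p` convergence (`tendstoInMeasure_of_tendsto_eLpNorm`, `TendstoInMeasure.exists_seq_tendsto_ae`)
and Fatou (`lintegral_liminf_le'`), but no packaged "interpolation of strong convergence"
(searched `eLpNorm`+`rpow_mul`, `interpolation` in `MeasureTheory/Function/LpSeminorm`). The tree
has the analogous pointwise interpolations `lintegral_pow_three_le_Lp_interpolation` (`L³ ⊂ (L², L⁶)`,
`CKNInterpolationEstimate`) and `lintegral_rpow_tenThirds_le_Lp_interpolation`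
(`CKNTenThirdsInterpolation`), not the `(L², L^{10/3})` pair nor the convergence statements.

## References

* L. Caffarelli, R. Kohn, L. Nirenberg, CPAM 35 (1982), §2. [CaffarelliKohnNirenberg1982]
* P. G. Lemarié-Rieusset, *The Navier–Stokes problem in the 21st century* (2016), Thm. 14.1,
  Step 3. [Lemarierieusset2016]
* Z. Bradshaw, T.-P. Tsai, Analysis & PDE 12 (2019) = arXiv:1801.08060, §4.3. [BradshawTsai2019]
-/

noncomputable section

open MeasureTheory Set Function Filter Topology
open scoped ENNReal NNReal

namespace Literature.Analysis.FunctionSpaces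

variable {X : Type*} [MeasurableSpace X] {μ : Measure X}
variable {F : Type*} [NormedAddCommGroup F]

/-! ### The pointwise interpolation `L³ ⊂ (L², L^{10/3})` -/

/-- **Lebesgue interpolation `L³ ⊂ (L², L^{10/3})`**:
`∫ ‖h‖³ ≤ (∫ ‖h‖²)^{1/4} (∫ ‖h‖^{10/3})^{3/4}` (Hölder with the conjugate exponents `4` and `4/3`
applied to `‖h‖^{1/2} · ‖h‖^{5/2}`; i.e. `‖h‖₃ ≤ ‖h‖₂^{1/6} ‖h‖_{10/3}^{5/6}`). [folklore] -/
theorem lintegral_enorm_rpow_three_le_sq_tenThirds (μ : Measure X) {h : X → F}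
    (hh : AEStronglyMeasurable h μ) :
    ∫⁻ x, ‖h x‖ₑ ^ (3 : ℝ) ∂μ ≤
      (∫⁻ x, ‖h x‖ₑ ^ (2 : ℝ) ∂μ) ^ (1 / 4 : ℝ) *
        (∫⁻ x, ‖h x‖ₑ ^ (10 / 3 : ℝ) ∂μ) ^ (3 / 4 : ℝ) := by
  have hpq : (4 : ℝ).HolderConjugate (4 / 3) :=
    Real.holderConjugate_iff.2 ⟨by norm_num, by norm_num⟩
  have hm1 : AEMeasurable (fun x => ‖h x‖ₑ ^ (1 / 2 : ℝ)) μ := hh.enorm.pow_const _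
  have hm2 : AEMeasurable (fun x => ‖h x‖ₑ ^ (5 / 2 : ℝ)) μ := hh.enorm.pow_const _
  have key := ENNReal.lintegral_mul_le_Lp_mul_Lq μ hpq hm1 hm2
  have e1 : ∀ x, ((fun x => ‖h x‖ₑ ^ (1 / 2 : ℝ)) * fun x => ‖h x‖ₑ ^ (5 / 2 : ℝ)) x =
      ‖h x‖ₑ ^ (3 : ℝ) := fun x => by
    rw [Pi.mul_apply, ← ENNReal.rpow_add_of_nonneg _ _ (by norm_num) (by norm_num)]
    norm_num
  have e2 : ∀ x, (‖h x‖ₑ ^ (1 / 2 : ℝ)) ^ (4 : ℝ) = ‖h x‖ₑ ^ (2 : ℝ) := fun x => by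
    rw [← ENNReal.rpow_mul]; norm_num
  have e3 : ∀ x, (‖h x‖ₑ ^ (5 / 2 : ℝ)) ^ (4 / 3 : ℝ) = ‖h x‖ₑ ^ (10 / 3 : ℝ) := fun x => by
    rw [← ENNReal.rpow_mul]; norm_num
  simp_rw [e1, e2, e3] at key
  rw [show (1 / (4 / 3) : ℝ) = 3 / 4 by norm_num] at key
  exact key

/-! ### Uniform bounds pass to `L²` limits -/

/-- The `L²` distance in `eLpNorm` form is the square root of `∫ ‖f − g‖ₑ²`. [folklore] -/
theorem eLpNorm_two_sub_eq_rpow_lintegral_sq (f g : X → F) :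
    eLpNorm (f - g) 2 μ = (∫⁻ x, ‖f x - g x‖ₑ ^ 2 ∂μ) ^ (1 / 2 : ℝ) := by
  rw [eLpNorm_eq_lintegral_rpow_enorm_toReal two_ne_zero ENNReal.ofNat_ne_top,
    ENNReal.toReal_ofNat]
  simp only [Pi.sub_apply, ENNReal.rpow_two, one_div]

/-- `∫ ‖fₖ − g‖ₑ² → 0` gives `‖fₖ − g‖_{L²} → 0`. [folklore] -/
theorem tendsto_eLpNorm_two_of_tendsto_lintegral_sq {f : ℕ → X → F} {g : X → F}
    (hlim : Tendsto (fun k => ∫⁻ x, ‖f k x - g x‖ₑ ^ 2 ∂μ) atTop (𝓝 0)) :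
    Tendsto (fun k => eLpNorm (f k - g) 2 μ) atTop (𝓝 0) := by
  have h1 := ((ENNReal.continuous_rpow_const (y := (1 / 2 : ℝ))).tendsto 0).comp hlim
  rw [ENNReal.zero_rpow_of_pos (by norm_num)] at h1
  refine h1.congr fun k => ?_
  simp only [comp_apply]
  exact (eLpNorm_two_sub_eq_rpow_lintegral_sq (f k) g).symm

/-- **A uniform bound `∫ ‖fₖ‖^r ≤ M` passes to `L²` limits**: if `fₖ → g` in `L²(μ)`
(`∫ ‖fₖ − g‖ₑ² → 0`) and `∫ ‖fₖ‖ₑ^r ≤ M` for all `k` (`r` real), then `∫ ‖g‖ₑ^r ≤ M`. Proof: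
`L²` convergence gives convergence in measure, hence a.e. convergence along a subsequence, and
Fatou's lemma applies (Brezis 2011, Thm. 4.9 and Lemma 4.1). [folklore] -/
theorem lintegral_enorm_rpow_le_of_tendsto_lintegral_sq {f : ℕ → X → F} {g : X → F}
    (hf : ∀ k, AEStronglyMeasurable (f k) μ) (hg : AEStronglyMeasurable g μ)
    (hlim : Tendsto (fun k => ∫⁻ x, ‖f k x - g x‖ₑ ^ 2 ∂μ) atTop (𝓝 0))
    (r : ℝ) {M : ℝ≥0∞} (hM : ∀ k, ∫⁻ x, ‖f k x‖ₑ ^ r ∂μ ≤ M) :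
    ∫⁻ x, ‖g x‖ₑ ^ r ∂μ ≤ M := by
  have h2 := tendsto_eLpNorm_two_of_tendsto_lintegral_sq hlim
  have hmeas : TendstoInMeasure μ f atTop g := tendstoInMeasure_of_tendsto_eLpNorm two_ne_zero hf hg h2
  obtain ⟨ns, -, hae⟩ := hmeas.exists_seq_tendsto_ae
  have hpt : ∀ᵐ x ∂μ, Tendsto (fun i => ‖f (ns i) x‖ₑ ^ r) atTop (𝓝 (‖g x‖ₑ ^ r)) := by
    filter_upwards [hae] with x hx
    exact ((ENNReal.continuous_rpow_const (y := r)).tendsto _).comp hx.enorm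
  calc ∫⁻ x, ‖g x‖ₑ ^ r ∂μ = ∫⁻ x, liminf (fun i => ‖f (ns i) x‖ₑ ^ r) atTop ∂μ := by
        refine lintegral_congr_ae ?_
        filter_upwards [hpt] with x hx
        rw [hx.liminf_eq]
    _ ≤ liminf (fun i => ∫⁻ x, ‖f (ns i) x‖ₑ ^ r ∂μ) atTop :=
        lintegral_liminf_le' fun i => (hf (ns i)).enorm.pow_const r
    _ ≤ M := liminf_le_of_frequently_le' (Frequently.of_forall fun i => hM (ns i))

/-! ### `L²` convergence with a uniform `L^{10/3}` bound gives `L³` convergence -/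

/-- **Strong `L³` convergence from strong `L²` convergence and a uniform `L^{10/3}` bound**
(CKN 1982, §2; Lemarié-Rieusset 2016, Thm. 14.1, Step 3; Bradshaw–Tsai 2019, §4.3): if
`∫ ‖fₖ − g‖ₑ² → 0` and `∫ ‖fₖ‖ₑ^{10/3} ≤ M < ∞` for all `k`, then `∫ ‖fₖ − g‖ₑ³ → 0`. Indeed
`∫ ‖g‖^{10/3} ≤ M` (`lintegral_enorm_rpow_le_of_tendsto_lintegral_sq`), so
`∫ ‖fₖ − g‖^{10/3} ≤ 2^{7/3} · 2M`, and
`∫ ‖fₖ − g‖³ ≤ (∫ ‖fₖ − g‖²)^{1/4} (2^{7/3} · 2M)^{3/4} → 0`. [cite: BradshawTsai2019, §4.3 (proof of Thm 1.2, "hence also in L^{10/3} … in L³")] -/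
theorem tendsto_lintegral_enorm_rpow_three_of_sq_of_tenThirds {f : ℕ → X → F} {g : X → F}
    (hf : ∀ k, AEStronglyMeasurable (f k) μ) (hg : AEStronglyMeasurable g μ)
    (hlim : Tendsto (fun k => ∫⁻ x, ‖f k x - g x‖ₑ ^ 2 ∂μ) atTop (𝓝 0))
    {M : ℝ≥0∞} (hM : M ≠ ∞) (hbd : ∀ k, ∫⁻ x, ‖f k x‖ₑ ^ (10 / 3 : ℝ) ∂μ ≤ M) :
    Tendsto (fun k => ∫⁻ x, ‖f k x - g x‖ₑ ^ (3 : ℝ) ∂μ) atTop (𝓝 0) := by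
  have hgb : ∫⁻ x, ‖g x‖ₑ ^ (10 / 3 : ℝ) ∂μ ≤ M :=
    lintegral_enorm_rpow_le_of_tendsto_lintegral_sq hf hg hlim _ hbd
  have h2top : (2 : ℝ≥0∞) ^ (10 / 3 - 1 : ℝ) ≠ ∞ :=
    ENNReal.rpow_ne_top_of_nonneg (by norm_num) ENNReal.ofNat_ne_top
  -- the uniform `L^{10/3}` bound of the differences
  have hdiff : ∀ k, ∫⁻ x, ‖f k x - g x‖ₑ ^ (10 / 3 : ℝ) ∂μ ≤ 2 ^ (10 / 3 - 1 : ℝ) * (M + M) := by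
    intro k
    calc ∫⁻ x, ‖f k x - g x‖ₑ ^ (10 / 3 : ℝ) ∂μ
        ≤ ∫⁻ x, 2 ^ (10 / 3 - 1 : ℝ) * (‖f k x‖ₑ ^ (10 / 3 : ℝ) + ‖g x‖ₑ ^ (10 / 3 : ℝ)) ∂μ := by
          refine lintegral_mono fun x => ?_
          calc ‖f k x - g x‖ₑ ^ (10 / 3 : ℝ) ≤ (‖f k x‖ₑ + ‖g x‖ₑ) ^ (10 / 3 : ℝ) :=
                ENNReal.rpow_le_rpow (enorm_sub_le (E := F)) (by norm_num)
            _ ≤ 2 ^ (10 / 3 - 1 : ℝ) * (‖f k x‖ₑ ^ (10 / 3 : ℝ) + ‖g x‖ₑ ^ (10 / 3 : ℝ)) :=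
                ENNReal.rpow_add_le_mul_rpow_add_rpow _ _ (by norm_num)
      _ = 2 ^ (10 / 3 - 1 : ℝ) *
            ((∫⁻ x, ‖f k x‖ₑ ^ (10 / 3 : ℝ) ∂μ) + ∫⁻ x, ‖g x‖ₑ ^ (10 / 3 : ℝ) ∂μ) := by
          rw [lintegral_const_mul' _ _ h2top, lintegral_add_left' ((hf k).enorm.pow_const _)]
      _ ≤ 2 ^ (10 / 3 - 1 : ℝ) * (M + M) := by
          gcongr
          exact hbd k
  -- interpolation
  set B : ℝ≥0∞ := (2 ^ (10 / 3 - 1 : ℝ) * (M + M)) ^ (3 / 4 : ℝ) with hB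
  have hBtop : B ≠ ∞ :=
    ENNReal.rpow_ne_top_of_nonneg (by norm_num) (ENNReal.mul_ne_top h2top (by simp [hM]))
  have hle : ∀ k, ∫⁻ x, ‖f k x - g x‖ₑ ^ (3 : ℝ) ∂μ ≤
      (∫⁻ x, ‖f k x - g x‖ₑ ^ 2 ∂μ) ^ (1 / 4 : ℝ) * B := by
    intro k
    have h := lintegral_enorm_rpow_three_le_sq_tenThirds μ ((hf k).sub hg)
    simp only [Pi.sub_apply, ENNReal.rpow_two] at h
    calc ∫⁻ x, ‖f k x - g x‖ₑ ^ (3 : ℝ) ∂μ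
        ≤ (∫⁻ x, ‖f k x - g x‖ₑ ^ 2 ∂μ) ^ (1 / 4 : ℝ) *
            (∫⁻ x, ‖f k x - g x‖ₑ ^ (10 / 3 : ℝ) ∂μ) ^ (3 / 4 : ℝ) := h
      _ ≤ (∫⁻ x, ‖f k x - g x‖ₑ ^ 2 ∂μ) ^ (1 / 4 : ℝ) * B := by
          rw [hB]
          gcongr
          exact hdiff k
  have h0 : Tendsto (fun k => (∫⁻ x, ‖f k x - g x‖ₑ ^ 2 ∂μ) ^ (1 / 4 : ℝ) * B) atTop (𝓝 0) := by
    have h1 := ((ENNReal.continuous_rpow_const (y := (1 / 4 : ℝ))).tendsto 0).comp hlim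
    rw [ENNReal.zero_rpow_of_pos (by norm_num)] at h1
    have h3 := ENNReal.Tendsto.mul_const h1 (Or.inr hBtop)
    rwa [zero_mul] at h3
  exact tendsto_of_tendsto_of_tendsto_of_le_of_le tendsto_const_nhds h0 (fun _ => zero_le) hle

/-- The `L³` distance in `eLpNorm` form is the cube root of `∫ ‖f − g‖ₑ³`. [folklore] -/
theorem eLpNorm_three_sub_eq_rpow_lintegral (f g : X → F) :
    eLpNorm (f - g) 3 μ = (∫⁻ x, ‖f x - g x‖ₑ ^ (3 : ℝ) ∂μ) ^ (1 / 3 : ℝ) := by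
  rw [eLpNorm_eq_lintegral_rpow_enorm_toReal (by norm_num) ENNReal.ofNat_ne_top,
    ENNReal.toReal_ofNat]
  simp only [Pi.sub_apply, one_div]

/-- **`eLpNorm` form**: `fₖ → g` in `L²` with `∫ ‖fₖ‖^{10/3} ≤ M < ∞` implies
`‖fₖ − g‖_{L³} → 0`. [cite: BradshawTsai2019, §4.3 (proof of Thm 1.2)] -/
theorem tendsto_eLpNorm_three_of_sq_of_tenThirds {f : ℕ → X → F} {g : X → F}
    (hf : ∀ k, AEStronglyMeasurable (f k) μ) (hg : AEStronglyMeasurable g μ)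
    (hlim : Tendsto (fun k => ∫⁻ x, ‖f k x - g x‖ₑ ^ 2 ∂μ) atTop (𝓝 0))
    {M : ℝ≥0∞} (hM : M ≠ ∞) (hbd : ∀ k, ∫⁻ x, ‖f k x‖ₑ ^ (10 / 3 : ℝ) ∂μ ≤ M) :
    Tendsto (fun k => eLpNorm (f k - g) 3 μ) atTop (𝓝 0) := by
  have h := tendsto_lintegral_enorm_rpow_three_of_sq_of_tenThirds hf hg hlim hM hbd
  have h1 := ((ENNReal.continuous_rpow_const (y := (1 / 3 : ℝ))).tendsto 0).comp h
  rw [ENNReal.zero_rpow_of_pos (by norm_num)] at h1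
  refine h1.congr fun k => ?_
  simp only [comp_apply]
  exact (eLpNorm_three_sub_eq_rpow_lintegral (f k) g).symm

/-- **`L^{10/3} ⊂ L³` on a finite measure space**, lintegral form: an a.e.-strongly measurable
`f` with `∫ ‖f‖ₑ^{10/3} ≤ M < ∞` is in `L³(μ)`. [folklore] -/
theorem memLp_three_of_lintegral_tenThirds_le [IsFiniteMeasure μ] {f : X → F}
    (hf : AEStronglyMeasurable f μ) {M : ℝ≥0∞} (hM : M ≠ ∞)
    (h : ∫⁻ x, ‖f x‖ₑ ^ (10 / 3 : ℝ) ∂μ ≤ M) : MemLp f 3 μ := by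
  have hp0 : (0 : ℝ) < 10 / 3 := by norm_num
  have hmem : MemLp f (ENNReal.ofReal (10 / 3)) μ := by
    refine ⟨hf, ?_⟩
    rw [eLpNorm_lt_top_iff_lintegral_rpow_enorm_lt_top (ENNReal.ofReal_pos.2 hp0).ne'
      ENNReal.ofReal_ne_top, ENNReal.toReal_ofReal hp0.le]
    exact h.trans_lt hM.lt_top
  refine hmem.mono_exponent ?_
  rw [show (3 : ℝ≥0∞) = ENNReal.ofReal 3 from (ENNReal.ofReal_ofNat 3).symm]
  exact ENNReal.ofReal_le_ofReal (by norm_num)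

/-- **The `L²` limit is in `L³`** (finite measure space): if `fₖ → g` in `L²` and
`∫ ‖fₖ‖^{10/3} ≤ M < ∞`, then `g ∈ L³(μ)` (indeed `∫ ‖g‖^{10/3} ≤ M`). [folklore] -/
theorem memLp_three_limit_of_sq_of_tenThirds [IsFiniteMeasure μ] {f : ℕ → X → F} {g : X → F}
    (hf : ∀ k, AEStronglyMeasurable (f k) μ) (hg : AEStronglyMeasurable g μ)
    (hlim : Tendsto (fun k => ∫⁻ x, ‖f k x - g x‖ₑ ^ 2 ∂μ) atTop (𝓝 0))
    {M : ℝ≥0∞} (hM : M ≠ ∞) (hbd : ∀ k, ∫⁻ x, ‖f k x‖ₑ ^ (10 / 3 : ℝ) ∂μ ≤ M) :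
    MemLp g 3 μ :=
  memLp_three_of_lintegral_tenThirds_le hg hM
    (lintegral_enorm_rpow_le_of_tendsto_lintegral_sq hf hg hlim _ hbd)

end Literature.Analysis.FunctionSpaces
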